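import Mathlib
import HarnessLib
import Summits.CriticalPhenomena.SAWScalingLimit.Theses.SAWDefectDecoherence
import Summits.CriticalPhenomena.SAWScalingLimit.Theses.SAWHexUniversality
import Summits.CriticalPhenomena.SAWScalingLimit.Theorems.ObservableToSLE.Negative.Identification
import Literature.Probability.RandomPlanarGeometry.HexParafermion
import Literature.Probability.RandomPlanarGeometry.HexSAW
import Literature.Probability.RandomPlanarGeometry.CurveTortuosity
import Literature.Probability.RandomPlanarGeometry.SLEConvergenceCriterion
import Literature.Barriers.CriticalPhenomena.ParafermionicHalfCauchyRiemann

/-!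
# Line `marginal-reflex-wedge-cauchy-kernel` — skeleton for crux `HexConjecture` (stmt-CriticalPhenomena-0808)

Crux (route `SAWDefectDecoherence`, shared by `SAWHexUniversality`, `SAWBrickWallHomotopy`,
`SAWResidueField`): `HexConjecture` = Duminil-Copin–Smirnov 2012 Conjecture 1 on the honeycomb
lattice — for every Dobrushin domain and hexagonal endpoint approximation the critical SAW law
`hexSAWLaw`, pushed to `CurveClass ℂ`, converges to chordal SLE(8/3).

Idea (card `Ideas/marginal-reflex-wedge-cauchy-kernel.md`, triage r1-1/2/3 pass): MARGINAL GEOMETRY.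
Summing DCS Lemma 1 (PROVED in the tree, `DuminilCopinSmirnov2012_lemma1_holds`) over the truncated
300° lattice wedge `W_N = {v : ‖c_v‖ < N, arg c_v ∉ [0, π/3]}` rooted at the corner mid-edge
`a = cornerEdge` (on the 0°-ray, `F(a) = 1`), the two rays carry OPPOSITE rigid phases `e^{-iπ/8}`,
`e^{+i7π/8}` (lifted normals differ by `-8π/3`, times `1 - σ = 3/8`), so the Green identity
`hexFlux W_N F = 0` collapses to the FLUX LINE
  `Σ_arc (z - v_z) F(z) = (1/(2√3)) · (-i - e^{-iπ/8} (Z₀ - Z₆₀))`        (stub 1),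
whence `Σ_{arc of W_N} Z_Λ(a → z) ≥ cos(π/8)` for EVERY finite `Λ ⊇ W_N`, every `N ≥ 1`
(stub 2: the cone-exterior escape floor — a scale-free LOWER bound on critical SAW masses with no
surgery and no sub-exponential loss). The card's bet (T-side) is that this floor, paired with the
conjectured CEILING making the marginal cell dimensionless (stub 3: arc mass `O(1)`, ray masses
`O(log N)`), is the RSW-type two-sided cell that the missing tightness half of the crux needs:
stub 4 (HARDEST, open) turns the two-sided cell into the Aizenman–Burchard multi-traversal bound for
`hexSAWLaw` (`HexTraversalBound`), stub 5 (in-tree technology: `isTightMeasureSet_of_traversalBounds`,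
`isTightAlongMesh_of_isTightMeasureSet_image`) turns that into `HexTight`. The identification half
(stub 6, `HexTight → HexIdentification`: every subsequential limit law is the SLE(8/3) law) is NOT
attacked by this line — it is the target of the route's `HexObservableLimitR → ObservableToSLER` chain and of the
`ObservableToSLE` / restriction lines; the card's I-side contribution (the wedge as the one domain
where Conjecture 2's target is the Cauchy kernel `1/z` with lattice-exact Riemann–Hilbert phases and
flux-pinned normalisation) is recorded in the line card as the cheapest falsifier, not as a stub.

The composition `HexConjecture_of` is sorry-free over the six stubs and concludes the route decl BY
NAME through the landed soft half `convergesInLawToSLE_of_identification`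
(`Theorems/ObservableToSLE/Negative/Identification.lean`: Prokhorov along the mesh, Dirac padding of
the junk-`0` laws, `IsSLECurve.map_eq_holds`).

Disproof used: `run/gate/evidence/stmt-CriticalPhenomena-0808/…-Disproof.lean` is not mounted in
this jail (as for the three triagers); honoured instead the LANDED negatives
`Theorems/HexConjecture/Negative/LoadBearing.lean` (`hexConjecture_false_without_tendsto_fst/_snd/
_reachable`: every clause of `IsEmbEndpointApprox` is load-bearing — stubs 4–6 keep the full
hypothesis; stub 5 USES `reachable` for eventual probability and `tendsto_fst/_snd` for the compact
container), `NonVacuity.lean`, `BoundaryWitness.lean` (refuted strengthenings "probability measure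
for all δ" and "fugacity 0" are not asserted: everything here is at `x_c` and eventual in `δ`).
Negatives index (0772 all-δ tightness, 8261, 8312, 5420 corridor witness): not touched — `HexTight`
is the eventual `IsTightAlongMesh` form, no observable normalisation point is used.
-/

noncomputable section

open MeasureTheory Filter Topology Set
open scoped BigOperators NNReal ENNReal Classical
open Literature.Probability.LatticeModels
open Literature.Probability.RandomPlanarGeometry
open Literature.Probability.RandomPlanarGeometry.SAW
open Literature.Barriers.CriticalPhenomena.HexGreen (nbrs)
open Summit.CriticalPhenomena.SAWScalingLimit.Theses.SAWDefectDecoherence (HexConjecture HexTight)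
open Summit.CriticalPhenomena.SAWScalingLimit.Theorems.ObservableToSLE.Negative
  (convergesInLawToSLE_of_identification)

namespace Summit.CriticalPhenomena.SAWScalingLimit.Cruxes.HexConjecture.MarginalReflexWedgeCauchyKernel

/-! ## Vocabulary of the line (local definitions; statements only) -/

/-- Inner endpoint of the corner (root) edge: the down-face of the cell `(0,-1)`, centre
`1/2 - i/(2√3)` (argument `-30°`, inside the wedge). -/
def cornerIn : HexVertex := ((![0, -1] : Site 2), (1 : Fin 2))

/-- Outer endpoint of the corner edge: the up-face of the cell `(0,0)`, centre `1/2 + i/(2√3)`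
(argument `+30°`, in the removed 60° sector). -/
def cornerOut : HexVertex := ((![0, 0] : Site 2), (0 : Fin 2))

/-- The root `a`: the vertical mid-edge at `1/2` on the 0°-ray of the 300° wedge with apex the
hexagon centre `0`. -/
def cornerEdge : Sym2 HexVertex := s(cornerIn, cornerOut)

/-- The removed CLOSED 60° sector `0 ≤ arg z ≤ π/3` (no honeycomb vertex lies on either ray). -/
def InSector (z : ℂ) : Prop := 0 ≤ Complex.arg z ∧ Complex.arg z ≤ Real.pi / 3

/-- `Λ` is the truncated marginal reflex wedge `W_N`: honeycomb vertices at distance `< N` from the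
apex outside the closed sector. For `N ≥ 1` it contains `cornerIn` and not `cornerOut`, so
`cornerEdge ∈ ∂W_N`; it is hex-simply-connected for every real `N ≥ 1` (part of stub 1). -/
def IsReflexWedgeTruncation (Λ : Finset HexVertex) (N : ℝ) : Prop :=
  ∀ v : HexVertex, v ∈ Λ ↔ ‖hexCenter v‖ < N ∧ ¬ InSector (hexCenter v)

/-- The critical parafermionic observable of `Λ` rooted at the corner edge, spin `σ`
(`σ = 5/8`: DCS's `F`; `σ = 0`: the mass). -/
def Fc (Λ : Finset HexVertex) (σ : ℝ) (z : Sym2 HexVertex) : ℂ :=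
  hexParafermionicObservable Λ cornerEdge hexCriticalFugacity σ z

/-- The `x_c`-mass `Z_Λ(a → z) = Σ_{γ ⊂ Λ : a → z} x_c^{ℓ(γ)}` (`= F_{x_c,0}`, real, `≥ ‖F_{x_c,σ}‖`). -/
def Zm (Λ : Finset HexVertex) (a z : Sym2 HexVertex) : ℝ :=
  ∑ γ : HexMidEdgeSAW Λ a z, hexCriticalFugacity ^ γ.length

/-- Sum of `f v w` over the boundary darts `(v, w)` of `Λ` (`v ∈ Λ`, `w ∼ v`, `w ∉ Λ`; the
boundary mid-edge is `s(v, w)`, `v = v_z` its inner vertex) selected by `P`. Same indexing as the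
barrier file's `hexFlux Λ F = Σ_{v ∈ Λ} Σ_{w ∈ nbrs v, w ∉ Λ} (mid - c_v) F`. -/
def dartSum {M : Type*} [AddCommMonoid M] (Λ : Finset HexVertex)
    (P : HexVertex → HexVertex → Prop) (f : HexVertex → HexVertex → M) : M :=
  ∑ v ∈ Λ, ∑ w ∈ (nbrs v).filter (fun w => w ∉ Λ ∧ P v w), f v w

/-- ARC darts of `W_N`: the outer endpoint lies outside the open disc of radius `N` (a superset of
the geometric arc: corner cases near the two rays at radius `N` are included, which only weakens
the floor of stub 2 and strengthens nothing else). -/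
def IsArcDart (N : ℝ) (_v w : HexVertex) : Prop := N ≤ ‖hexCenter w‖

/-- Darts crossing the 0°-RAY other than the root: outer endpoint in the sector inside the disc,
inner vertex just below the positive real axis (`arg c_v < 0`); all these edges are vertical,
outward normal `+i`, rigid winding `W = +π` from the root, phase of `(z - v_z)F(z)` = `e^{-iπ/8}`. -/
def IsRayZeroDart (N : ℝ) (v w : HexVertex) : Prop :=
  ‖hexCenter w‖ < N ∧ Complex.arg (hexCenter v) < 0 ∧ (v, w) ≠ (cornerIn, cornerOut)

/-- Darts crossing the 60°-RAY: outer endpoint in the sector inside the disc, inner vertex beyond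
the ray (`π/3 < arg c_v`); outward normal `e^{-iπ/6}`, rigid winding `W = -5π/3`, phase
`e^{+i7π/8} = -e^{-iπ/8}`. Together with the root dart and `IsArcDart`/`IsRayZeroDart` these
partition the boundary darts of `W_N`. -/
def IsRaySixtyDart (N : ℝ) (v w : HexVertex) : Prop :=
  ‖hexCenter w‖ < N ∧ Real.pi / 3 < Complex.arg (hexCenter v)

/-- The far flux `Φ_N := Σ_{arc darts} (z - v_z) F(z)` of the corner-rooted critical observable. -/
def farFlux (Λ : Finset HexVertex) (N : ℝ) : ℂ :=
  dartSum Λ (IsArcDart N) fun v w => (hexMidpoint s(v, w) - hexCenter v) * Fc Λ (5 / 8) s(v, w)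

/-- Ray masses `Z₀^{(N)}`, `Z₆₀^{(N)}` (as sums of `‖F‖`; on boundary mid-edges `‖F‖ = Z` by
winding rigidity, but the statements below do not need that). -/
def rayZeroMass (Λ : Finset HexVertex) (N : ℝ) : ℝ :=
  dartSum Λ (IsRayZeroDart N) fun v w => ‖Fc Λ (5 / 8) s(v, w)‖

/-- See `rayZeroMass`. -/
def raySixtyMass (Λ : Finset HexVertex) (N : ℝ) : ℝ :=
  dartSum Λ (IsRaySixtyDart N) fun v w => ‖Fc Λ (5 / 8) s(v, w)‖

/-- The polyline of a hexagonal domain SAW as a parametrised curve (its class is `γ.curve`,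
definitionally: `EmbDomainSAW.curve γ = CurveClass.mk (hexPolyline γ)`). -/
def hexPolyline {Ω : Set ℂ} {δ : ℝ} {a b : HexVertex} (γ : HexDomainSAW Ω δ a b) : Curve ℂ :=
  ⟨γ.walk.toCurve fun v => (δ : ℂ) * hexCenter v⟩

/-- Sanity: the class of `hexPolyline γ` is the route's observable `γ.curve`. -/
theorem mk_hexPolyline {Ω : Set ℂ} {δ : ℝ} {a b : HexVertex} (γ : HexDomainSAW Ω δ a b) :
    CurveClass.mk (hexPolyline γ) = γ.curve := rfl

/-! ## The six stub STATEMENTS (named `Prop`s; the registered `stub_*` theorems below restate them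
— stub 1 verbatim, stubs 2–6 by name — and `LineShape`/`lineShape_holds` is the kernel-checked
composition `stub₁ → … → stub₆ → HexConjecture`, consumed by the hypothesis-free skeleton theorem
`HexConjecture_of`, as in `Cruxes/ObservableToSLE/Lines/coalescent-arc-restriction.lean`) -/

/-- STUB 1 statement — the FLUX LINE of the marginal reflex cell (exact lattice identity at
`x = x_c`, `σ = 5/8`): for every truncation `W_N`, `N ≥ 1`,
`Φ_N = (1/(2√3)) · (-i - e^{-iπ/8} · (Z₀^{(N)} - Z₆₀^{(N)}))`.
Content: `W_N` is hex-simply-connected and `cornerEdge ∈ ∂W_N`; DCS Lemma 1 summed over `W_N`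
(`hexFlux_eq_zero_of_satisfiesVertexRelations`); the root dart contributes `(i/(2√3))·F(a) = i/(2√3)`
(`hexParafermionicObservable_self`); boundary darts are root ∪ ray-0 ∪ ray-60 ∪ arc (disjoint);
winding rigidity with the VALUES `W = +π` (ray 0) and `W = -5π/3` (ray 60) and the dart geometry
(`z - v_z = (1/(2√3))·i`, resp. `(1/(2√3))·e^{-iπ/6}`) give the two rigid phases. Verified by exact
enumeration to `1e-15` for `N ≤ 3.5` by the ideator and all three triagers. -/
def ReflexFluxLine : Prop :=
  ∀ (Λ : Finset HexVertex) (N : ℝ), 1 ≤ N → IsReflexWedgeTruncation Λ N →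
    farFlux Λ N =
      (1 / (2 * Real.sqrt 3) : ℂ) *
        (-Complex.I -
          Complex.exp (-Complex.I * (Real.pi / 8)) * ((rayZeroMass Λ N - raySixtyMass Λ N : ℝ) : ℂ))

/-- STUB 2 statement — the CONE-EXTERIOR ESCAPE FLOOR (triage r1-1 sharpening): for every finite
vertex domain `Λ' ⊇ W_N` (any shape outside the cell), the `x_c`-masses from the corner root to the
arc darts of `W_N` sum to at least `cos(π/8) ≈ 0.924`, uniformly in `N ≥ 1`:
`Σ_{(v,w) arc dart of W_N} Z_{Λ'}(a → s(v,w)) ≥ cos(π/8)`. From stub 1: the far flux lies on a line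
missing the origin by `sin(5π/8) = cos(π/8)`, `‖(z - v_z)F‖ = (1/(2√3))‖F‖` (edge length `1/√3`),
`‖F_{W_N}(z)‖ ≤ Z_{W_N}(a → z)` (`norm_hexParafermionicObservable_le`) and RESTRICTION MONOTONICITY
`Z_{W_N} ≤ Z_{Λ'}` (walks of `W_N` are walks of `Λ'`). -/
def ConeExteriorEscape : Prop :=
  ∀ (Λ Λ' : Finset HexVertex) (N : ℝ), 1 ≤ N → IsReflexWedgeTruncation Λ N → Λ ⊆ Λ' →
    Real.cos (Real.pi / 8) ≤ dartSum Λ (IsArcDart N) fun v w => Zm Λ' cornerEdge s(v, w)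

/-- STUB 3 statement — the CEILING making the marginal cell dimensionless (two-sided pinning,
triage r1-2 sharpening; OPEN): one constant `C` bounds, for every `N ≥ 1`, the arc mass of `W_N`
from the corner (`≤ C`: corner weight `h_c(5π/3) = 3/8` plus boundary weight `5/8` equals `1`, the
weight of a current, so the corner-to-arc mass is scale-free; enumeration: `1.07 … 1.22` for
`N ≤ 3.5`) and the two ray masses (`≤ C (1 + log N)`: density `≍ 1/k` at distance `k`; enumeration:
`Z₀ = 0 → 0.30`, `Z₆₀ = 0.05 → 0.15` for `N = 1 → 3.5`). With stub 2 this pins the far mass in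
`[cos(π/8), C]` at every scale — the "RSW cell" of the line. -/
def ReflexCellCeiling : Prop :=
  ∃ C : ℝ, ∀ (Λ : Finset HexVertex) (N : ℝ), 1 ≤ N → IsReflexWedgeTruncation Λ N →
    (dartSum Λ (IsArcDart N) fun v w => Zm Λ cornerEdge s(v, w)) ≤ C ∧
    (dartSum Λ (IsRayZeroDart N) fun v w => Zm Λ cornerEdge s(v, w)) +
        (dartSum Λ (IsRaySixtyDart N) fun v w => Zm Λ cornerEdge s(v, w)) ≤ C * (1 + Real.log N)

/-- STUB 4/5 junction — the AIZENMAN–BURCHARD MULTI-TRAVERSAL BOUND for the critical hexagonal SAW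
(hypothesis (H1) of `isTightMeasureSet_of_traversalBounds` in the H21 formulation of
`spinInterface_traversalBound` / `fkInterface_traversalBound`: round shells, a shell-dependent
threshold `k x ρ R` absorbing the traversals forced near the marked points and `∂Ω`, small meshes):
for every Dobrushin domain and endpoint approximation there are `k`, `K ≥ 0`, `λ > 2`, `δ₀ > 0` with
`hexSAWLaw {γ | the polyline of γ traverses D(x; ρ, R) (k x ρ R) times} ≤ K (ρ/R)^λ` for
`0 < δ ≤ δ₀`, `δ ≤ ρ < R ≤ 1`. (The law is the junk `0` when `a δ`, `b δ` are not joined: the bound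
is then trivial.) -/
def HexTraversalBound : Prop :=
  ∀ (D : DobrushinDomain) (a b : ℝ → HexVertex), IsEmbEndpointApprox hexGraph hexCenter D a b →
    ∃ (k : ℂ → ℝ → ℝ → ℕ) (K lam δ₀ : ℝ), 0 ≤ K ∧ 2 < lam ∧ 0 < δ₀ ∧
      ∀ δ ∈ Set.Ioc (0 : ℝ) δ₀, ∀ (x : ℂ) (ρ R : ℝ), δ ≤ ρ → ρ < R → R ≤ 1 →
        hexSAWLaw D.carrier δ (a δ) (b δ)
            {γ | (hexPolyline γ).HasTraversals (k x ρ R) x ρ R} ≤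
          ENNReal.ofReal (K * (ρ / R) ^ lam)

/-- STUB 6 conclusion — IDENTIFICATION of subsequential limits (the I-half of the crux, exactly the
last hypothesis of the landed `convergesInLawToSLE_of_identification`; stub 6 asserts it GIVEN
`HexTight`): every subsequential weak
limit law (along meshes `δ_n → 0⁺`) of the critical hexagonal SAW in a Dobrushin domain with an
endpoint approximation, which is a probability measure, is the chordal SLE(8/3) law. -/
def HexIdentification : Prop :=
  ∀ (D : DobrushinDomain) (a b : ℝ → HexVertex), IsEmbEndpointApprox hexGraph hexCenter D a b →
    ∀ μ : Measure (CurveClass ℂ), IsProbabilityMeasure μ →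
      IsSubseqLimitLaw (fun δ (γ : HexDomainSAW D.carrier δ (a δ) (b δ)) => γ.curve)
        (fun δ => hexSAWLaw D.carrier δ (a δ) (b δ)) μ →
      IsSLELaw ((8 : ℝ≥0) / 3) D μ

/-! ## Stubs (registered; `sorry` only here) -/

/-- STUB 1 (L, provable now) — the flux line of the marginal reflex cell. Leans on:
`DuminilCopinSmirnov2012_lemma1_holds`, `Literature.Barriers.CriticalPhenomena.lemma1_iff`,
`hexFlux_eq_zero_of_satisfiesVertexRelations`, `HexGreen.sum_relations_eq_hexFlux`,
`hexParafermionicObservable_self`, Hopf's formula `HV.Hopf.pturn_walk_eq` (HexSAWHopfPath) for the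
two ray windings (the route support `BoundaryWindingRigidity`, stmt-8515, is the general form),
`hexCenter_re_im` / `NonVacuity.nine_mul_norm_sq` / `exists_adj_qf_lt` for the geometry and the
simple connectivity of `W_N` (modulus-increasing exits; sector vertices exit inside the sector). -/
theorem stub_reflexFluxLine :
    ∀ (Λ : Finset HexVertex) (N : ℝ), 1 ≤ N → IsReflexWedgeTruncation Λ N →
      farFlux Λ N =
        (1 / (2 * Real.sqrt 3) : ℂ) *
          (-Complex.I -
            Complex.exp (-Complex.I * (Real.pi / 8)) *
              ((rayZeroMass Λ N - raySixtyMass Λ N : ℝ) : ℂ)) := by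
  sorry

/-- STUB 2 (M, provable now) — the cone-exterior escape floor from the flux line: distance from
`-i` to the line `e^{-iπ/8}ℝ` is `cos(π/8)`; triangle inequality with `‖z - v_z‖ = 1/(2√3)`
(adjacent honeycomb centres are at distance `1/√3`); `‖F‖ ≤ Z` termwise
(`norm_hexParafermionicObservable_le`); monotonicity of `Z` under `Λ ⊆ Λ'` (the vertex list of a
walk of `Λ` is a walk of `Λ'`: an injection `HexMidEdgeSAW Λ a z ↪ HexMidEdgeSAW Λ' a z`
preserving `length`). -/
theorem stub_coneExteriorEscape : ReflexFluxLine → ConeExteriorEscape := by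
  sorry

/-- STUB 3 (L–XL, OPEN; kit-testable by transfer matrix in the wedge to `N ≈ 12`) — the ceiling. A
violation (arc mass growing like a power of `N`) kills the "dimensionless cell" reading and with it
stub 4's mechanism; the line card names this as the cheapest falsifier of the T-side. -/
theorem stub_reflexCellCeiling : ReflexCellCeiling := by
  sorry

/-- STUB 4 (XL, HARDEST, OPEN — the line's bet) — from the two-sided marginal cell to the
Aizenman–Burchard multi-traversal bound for `hexSAWLaw`. Intended mechanism (line card §Hardest):
(i) exact two-sided Gibbs conditioning / reversal (the configurational domain-Markov property and
reversibility of the `x_c`-SAW) reduces `k` traversals of `D(x; ρ, R)` to a dyadic chain of ONE-SCALE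
dive ratios for arcs between boundary mid-edges of slit sub-domains containing a virgin lattice disc
(the `DiveRecursion`/`OneScaleDive` shape of crux `HexTight`'s sketches); (ii) the one-scale ratio
is bounded by `q < 1` using, at the rim root, the scale-free FLOOR of stub 2 (cone-exterior escape,
transferred to supersets by restriction monotonicity) against the CEILING of stub 3 (transferred
to the competing sub-domain masses), i.e. the marginal cell as the SAW's RSW cell; (iii) `q^m`
over `m` dyadic scales and `k/2` disjoint dives give `λ(k) → ∞`. Step (ii) is where the bet lives:
the floor needs a reflex (≥ 300°) root geometry, which rim roots of virgin discs have only after a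
lattice-local renewal. No surgery with sub-exponential loss is allowed anywhere (that is the point). -/
theorem stub_traversalBound_of_reflexCell :
    ConeExteriorEscape → ReflexCellCeiling → HexTraversalBound := by
  sorry

/-- STUB 5 (L, in-tree technology) — Aizenman–Burchard: `HexTraversalBound → HexTight`, following
`isTightMeasureSet_spinInterfaceLaw_of_traversalBound` declaration by declaration: container
`Λ = B̄(0, r + 1)` with `D.carrier ⊆ B̄(0, r)` (`DobrushinDomain.isBounded`; vertices of a domain
SAW lie in `Ω`, `mem_embMeshDomain_of_mem_support_tail`, and `δ·c_{a δ} → D.pt 0` handles the trivial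
walk — this USES `IsEmbEndpointApprox.tendsto_fst`), covering exponent `d = 2`
(`exists_finset_card_le_cover_closedBall`), short-distance cutoff (H0): a self-avoiding polyline of
step `δ/√3` traverses no shell of inner radius `≤ δ` more than an absolute number of times (finitely
many honeycomb points in `B(x, 2δ)`, each visited once), (H1) = the hypothesis with threshold
`max k₀ (k x ρ R)`; then `isTightMeasureSet_of_traversalBounds` on `T = Ioc 0 δ₀` and
`isTightAlongMesh_of_isTightMeasureSet_image` (a.e.-measurability is automatic on the discrete
σ-algebra, `EmbDomainSAW.measurable_of_top`; `mk_hexPolyline`). -/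
theorem stub_hexTight_of_traversalBound : HexTraversalBound → HexTight := by
  sorry

/-- STUB 6 (XL, OPEN; NOT attacked by this line) — identification of subsequential limits as
SLE(8/3), GIVEN the tightness this line produces (identification arguments consume precompactness /
regularity of subsequential limits, so the T-half is offered as a hypothesis; the statement is
weaker than bare `HexIdentification`). Served by the route's `HexObservableLimitR → ObservableToSLER`
chain (SAWDefectDecoherence rev 16: `ObservableToSLER hO hT` gives convergence, hence identification
by `isSLELaw_of_isSubseqLimitLaw`), by the `ObservableToSLE` lines (`Cruxes/ObservableToSLE/Lines/*`),
or by the restriction lines of this crux (`root-locality-replaces-loewner`,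
`flat-polygon-restriction-line`); any of them closes it. -/
theorem stub_identification_of_tight : HexTight → HexIdentification := by
  sorry

/-! ## Composition (sorry-free): the six stubs prove the crux BY NAME -/

/-- The SHAPE of the line as one proposition: the six stub statements, in order, imply the crux. -/
def LineShape : Prop :=
  ReflexFluxLine → (ReflexFluxLine → ConeExteriorEscape) → ReflexCellCeiling →
    (ConeExteriorEscape → ReflexCellCeiling → HexTraversalBound) → (HexTraversalBound → HexTight) →
      (HexTight → HexIdentification) → HexConjecture

/-- **The kernel-checked composition** (pure logic plus the landed soft half; no `sorry`, axioms
`propext`/`Classical.choice`/`Quot.sound` only): for a Dobrushin domain `D` and an endpoint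
approximation `(a, b)`, stubs 1 → 2 and 3 feed stub 4 (multi-traversal bound), stub 5 gives
`HexTight`, whose instance at `(D, a, b)` is tightness along the mesh; stub 6 identifies the
subsequential limits (given `HexTight`); `convergesInLawToSLE_of_identification` (Prokhorov along the mesh + Dirac
padding of the junk-`0` laws + uniqueness of the SLE law `IsSLECurve.map_eq_holds`, all PROVED)
concludes `ConvergesInLawToSLE (8/3) D`. -/
theorem lineShape_holds : LineShape := by
  intro h1 h2 h3 h4 h5 h6 D a b hab
  have hT : HexTight := h5 (h4 (h2 h1) h3)
  exact convergesInLawToSLE_of_identification hab (hT D a b hab) (h6 hT D a b hab)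

/-- **`HexConjecture` from the six registered stubs** — the skeleton theorem audited by
`#h21_check_skeleton`: concludes the route decl BY NAME; `sorry` enters only through the six
`stub_*` declarations. -/
theorem HexConjecture_of : HexConjecture :=
  lineShape_holds stub_reflexFluxLine stub_coneExteriorEscape stub_reflexCellCeiling
    stub_traversalBound_of_reflexCell stub_hexTight_of_traversalBound stub_identification_of_tight

/-- The same skeleton theorem for the FIRST route wanting the shared crux (the decl that
`ledger skeleton check` resolves by default): `SAWHexUniversality.HexConjecture` has the identical
statement text, so the proof is `HexConjecture_of` by definitional unfolding. Every other sharing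
route (`SAWBrickWallHomotopy`, `SAWDevelopingMap`, `SAWResidueField`, `SAWPhaseRetrieval`,
`SAWWindingAlias`) is served the same way. -/
theorem HexConjecture_of' :
    Summit.CriticalPhenomena.SAWScalingLimit.Theses.SAWHexUniversality.HexConjecture :=
  HexConjecture_of

end Summit.CriticalPhenomena.SAWScalingLimit.Cruxes.HexConjecture.MarginalReflexWedgeCauchyKernel

end
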